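import Literature.Analysis.FluidPDE.PeriodicCylinderExtension
import Literature.Analysis.FluidPDE.PeriodicCylinderCoordinates
import Mathlib.Analysis.Calculus.ContDiff.Bounds
import Mathlib.MeasureTheory.Function.Jacobian
import HarnessLib

/-!
# The radial Seeley extension: pointwise bounds for the derivatives of the reflected terms and
# the change of variables under the radial reflections

Analysis/FluidPDE support file, sequel of `PeriodicCylinderExtension.lean` (the radial Seeley
extension `cylExtend` across the wall of the periodic cylinder, for
`Literature.Analysis.FluidPDE.KatoLai1984_periodicCylinderUniformExistence`). On the collar
`{r > 1}` the raw extension is `∑_k T_k f`, `T_k f (x) = w_k(1 - r) f(R_k x)` (Seeley's weights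
`w_k = Seeley.weight (1/2) k`, radial reflections `R_k`, `rawExtend_of_one_lt`). This file proves
the two estimates from which the Sobolev bounds of the extension operator follow by summation
over `k` (Seeley 1964, proof of the Theorem: the `j`-th derivative of the `k`-th term carries the
factor `a_k 2^{kj}`, summable in `k` by the Lemma; the reflection `t ↦ -2^k t` has Jacobian
`2^{-k}`):

* `seeleyTerm k f = T_k f` and its smoothness on the active collar;
* `iteratedFDeriv_seeleyTerm_eq_zero` — `D^n T_k f (x) = 0` once `2^k (r - 1) > 1/4`;
* `norm_iteratedFDeriv_seeleyTerm_le` — **pointwise bound**: for every order `n` there is `K_n`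
  with `‖D^n (T_k f)(x)‖ ≤ K_n |a_k| 2^{kn} ∑_{l ≤ n} ‖D^l f (R_k x)‖` for all `k`, all `f` smooth
  on the closed cylinder and all `x` of the collar `{1 < r < 3/2}` with `2^k (r - 1) < 1/2`
  (Faà di Bruno bound `norm_iteratedFDerivWithin_comp_le` for `f ∘ R_k` with
  `‖D^i R_k‖ ≤ (D₀ 2^k)^i`, Leibniz `norm_iteratedFDerivWithin_smul_le` with
  `‖D^i (w_k ∘ ρ)‖ ≤ C |a_k| 2^{ki}`; the `k`-independent geometric factors `B = ((1-r)/r) x_h`,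
  `ρ = 1 - r` have bounded derivatives on the closed collar by compactness of a slice and
  invariance under axial translations);
* `setLIntegral_comp_radialReflect_le` — **change of variables**: for measurable `G ≥ 0`,
  `∫⁻_{1 < r, 2^k(r-1) < 1/4, 0 < z < L} G(R_k x) dx ≤ (5/3) 2^{-k} ∫⁻_{cell} G` (cylindrical
  coordinates `lintegral_eq_lintegral_cylCoord`, the affine substitution `ρ = 1 - 2^k (r - 1)` in
  the parameter space with `|det| = 2^k`, and `setLIntegral_cylinderCell_eq_lintegral_cylBoxOpen`).

Everything is proved; no named fact and no `sorry` is introduced.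

## Mathlib / tree search

Mathlib: `norm_iteratedFDerivWithin_comp_le`, `norm_iteratedFDerivWithin_smul_le`,
`ContinuousLinearMap.iteratedFDeriv_comp_right`, `iteratedFDerivWithin_of_isOpen`,
`iteratedFDeriv_comp_add_right`, `iteratedFDeriv_succ_eq_comp_right`, `fderiv_add_const`,
`lintegral_image_eq_lintegral_abs_det_fderiv_mul`, `LinearMap.det_toLin'`, `Matrix.det_diagonal`.
Tree: `Seeley.coeff`, `Seeley.weight`, `Seeley.cutoff`, `Seeley.cutoffBound`,
`Seeley.norm_iteratedFDeriv_cutoff_le` (`Calculus/SeeleyExtension`); `cylCoord`,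
`cylRadius_cylCoord`, `lintegral_eq_lintegral_cylCoord`,
`setLIntegral_cylinderCell_eq_lintegral_cylBoxOpen`, `mem_cylBoxOpen_iff` (`PeriodicCylinderFlux`,
`PeriodicCylinderCoordinates`).

## References

* R. T. Seeley, *Extension of `C^∞` functions defined in a half space*, Proc. Amer. Math. Soc. 15
  (1964) 625–626, Theorem and Lemma. [Seeley1964]
-/

noncomputable section

open MeasureTheory Set Function Filter Topology TopologicalSpace WithLp Finset
open scoped ContDiff NNReal ENNReal InnerProductSpace RealInnerProductSpace Nat

namespace Literature.Analysis.FluidPDE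

open Literature.Analysis.Calculus

/-- Local notation for physical space `ℝ³ = EuclideanSpace ℝ (Fin 3)`. -/
local notation "ℝ³" => EuclideanSpace ℝ (Fin 3)

/-- Local notation for the closed unit cylinder `{r ≤ 1}`. -/
local notation "𝕂" => closure (SetLike.coe unitCylinder : Set (EuclideanSpace ℝ (Fin 3)))

namespace PeriodicCylinder

variable {F : Type*} [NormedAddCommGroup F] [NormedSpace ℝ F]

/-! ### Bounded derivatives on compact sets -/

/-- A function `C^∞` on an open set has, on every compact subset, all derivatives up to a given
order bounded by one constant. [folklore] -/
theorem exists_bound_iteratedFDeriv_of_isCompact {E G : Type*} [NormedAddCommGroup E] [NormedSpace ℝ E]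
    [NormedAddCommGroup G] [NormedSpace ℝ G] {V K : Set E} (hV : IsOpen V) (hK : IsCompact K)
    (hKV : K ⊆ V) {g : E → G} (hg : ContDiffOn ℝ ∞ g V) (n : ℕ) :
    ∃ M : ℝ, 0 ≤ M ∧ ∀ i ≤ n, ∀ x ∈ K, ‖iteratedFDeriv ℝ i g x‖ ≤ M := by
  have hone : ∀ i : ℕ, ∃ M : ℝ, 0 ≤ M ∧ ∀ x ∈ K, ‖iteratedFDeriv ℝ i g x‖ ≤ M := by
    intro i
    have hc : ContinuousOn (iteratedFDerivWithin ℝ i g V) V :=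
      hg.continuousOn_iteratedFDerivWithin (by exact_mod_cast le_top) hV.uniqueDiffOn
    have hc' : ContinuousOn (iteratedFDeriv ℝ i g) V :=
      hc.congr fun x hx => (iteratedFDerivWithin_of_isOpen i hV hx).symm
    obtain ⟨M, hM⟩ := hK.exists_bound_of_continuousOn (hc'.mono hKV)
    exact ⟨max M 0, le_max_right _ _, fun x hx => (hM x hx).trans (le_max_left _ _)⟩
  choose M hM0 hM using hone
  refine ⟨∑ i ∈ range (n + 1), M i, sum_nonneg fun i _ => hM0 i, fun i hi x hx => ?_⟩
  exact (hM i x hx).trans (single_le_sum (fun j _ => hM0 j) (mem_range.2 (Nat.lt_succ_of_le hi)))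

/-- Adding a constant does not change the derivatives of positive order. [folklore] -/
theorem iteratedFDeriv_succ_add_const {E G : Type*} [NormedAddCommGroup E] [NormedSpace ℝ E]
    [NormedAddCommGroup G] [NormedSpace ℝ G] (g : E → G) (c : G) (i : ℕ) (x : E) :
    iteratedFDeriv ℝ (i + 1) (fun z => g z + c) x = iteratedFDeriv ℝ (i + 1) g x := by
  rw [iteratedFDeriv_succ_eq_comp_right, iteratedFDeriv_succ_eq_comp_right]
  have : (fun y => fderiv ℝ (fun z => g z + c) y) = fun y => fderiv ℝ g y :=
    funext fun y => fderiv_add_const c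
  simp only [comp_apply, this]

/-! ### The collar, the slice and the geometric factors -/

/-- The open collar `U = {1 < r < 3/2}` outside the wall. [folklore] -/
def collar : Set ℝ³ := {x | 1 < cylRadius x ∧ cylRadius x < 3 / 2}

/-- The collar is open. [folklore] -/
theorem isOpen_collar : IsOpen collar :=
  (isOpen_lt continuous_const continuous_cylRadius).inter (isOpen_lt continuous_cylRadius continuous_const)

/-- The `k`-th active collar `U_k = {x ∈ U | 2^k (r - 1) < 1/2}` (where the reflection lands in
the open cylinder). [folklore] -/
def collarK (k : ℕ) : Set ℝ³ := {x | x ∈ collar ∧ (2 : ℝ) ^ k * (cylRadius x - 1) < 1 / 2}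

/-- `U_k` is open. [folklore] -/
theorem isOpen_collarK (k : ℕ) : IsOpen (collarK k) :=
  isOpen_collar.inter (isOpen_lt (continuous_const.mul (continuous_cylRadius.sub continuous_const))
    continuous_const)

/-- The off-axis region `{r > 1/2}` containing the closed collar. [folklore] -/
def offAxis : Set ℝ³ := {x | 1 / 2 < cylRadius x}

/-- `{r > 1/2}` is open. [folklore] -/
theorem isOpen_offAxis : IsOpen offAxis := isOpen_lt continuous_const continuous_cylRadius

/-- The compact slice `{1 ≤ r ≤ 3/2, z = 0}` of the closed collar: derivative bounds of the
axially invariant geometric factors are obtained here and transported by translation. [folklore] -/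
def collarSlice : Set ℝ³ := {x | 1 ≤ cylRadius x ∧ cylRadius x ≤ 3 / 2 ∧ x 2 = 0}

/-- The slice is compact (closed and bounded). [folklore] -/
theorem isCompact_collarSlice : IsCompact collarSlice := by
  refine Metric.isCompact_of_isClosed_isBounded ?_ ?_
  · exact (isClosed_le continuous_const continuous_cylRadius).inter
      ((isClosed_le continuous_cylRadius continuous_const).inter
        (isClosed_eq ((EuclideanSpace.proj (2 : Fin 3)).continuous) continuous_const))
  · refine (Metric.isBounded_closedBall (x := (0 : ℝ³)) (r := 3 / 2)).subset fun x hx => ?_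
    obtain ⟨-, h2, h3⟩ := hx
    rw [Metric.mem_closedBall, dist_zero_right, EuclideanSpace.norm_eq, Fin.sum_univ_three, h3]
    have hr : x 0 ^ 2 + x 1 ^ 2 = cylRadius x ^ 2 := (cylRadius_sq x).symm
    simp only [Real.norm_eq_abs, sq_abs]
    rw [show x 0 ^ 2 + x 1 ^ 2 + (0 : ℝ) ^ 2 = cylRadius x ^ 2 by rw [← hr]; ring,
      Real.sqrt_sq (cylRadius_nonneg x)]
    exact h2

/-- The slice lies in `{r > 1/2}`. [folklore] -/
theorem collarSlice_subset_offAxis : collarSlice ⊆ offAxis := fun x hx => by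
  show 1 / 2 < cylRadius x
  linarith [hx.1]

/-- The axial shift vector `L e₂`. -/
local notation "𝐯" L':max => (L' : ℝ) • EuclideanSpace.single (2 : Fin 3) (1 : ℝ)

/-- Every point of the closed collar is an axial translate of a point of the slice. [folklore] -/
theorem exists_collarSlice_add {x : ℝ³} (h1 : 1 ≤ cylRadius x) (h2 : cylRadius x ≤ 3 / 2) :
    ∃ y ∈ collarSlice, x = y + 𝐯 (x 2) := by
  refine ⟨x + 𝐯 (-(x 2)), ⟨?_, ?_, ?_⟩, ?_⟩
  · rw [cylRadius_add_axialShift]; exact h1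
  · rw [cylRadius_add_axialShift]; exact h2
  · simp
  · rw [add_assoc, ← add_smul, neg_add_cancel, zero_smul, add_zero]

/-- The geometric factor `B x = ((1 - r)/r) x_h`: `R_k = id + (1 + 2^k) B`. [folklore] -/
def reflB (x : ℝ³) : ℝ³ := ((1 - cylRadius x) * (cylRadius x)⁻¹) • horizontalProjL x

/-- `R_k x = x + (1 + 2^k) B x`. [folklore] -/
theorem radialReflect_eq_add (k : ℕ) (x : ℝ³) : radialReflect k x = x + (1 + (2 : ℝ) ^ k) • reflB x := by
  rw [radialReflect_eq, reflB, smul_smul]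
  by_cases hx : cylRadius x = 0
  · -- on the axis `x_h = 0`
    have hh : horizontalProjL x = 0 := by
      rw [← norm_eq_zero, horizontalProjL_apply, norm_horizontalProj, hx]
    simp [hh]
  · have : (1 - (2 : ℝ) ^ k * (cylRadius x - 1)) * (cylRadius x)⁻¹ =
        1 + (1 + (2 : ℝ) ^ k) * ((1 - cylRadius x) * (cylRadius x)⁻¹) := by
      field_simp
      ring
    rw [this, add_smul, one_smul]
    abel

/-- `B` is smooth off the axis. [folklore] -/
theorem contDiffOn_reflB : ContDiffOn ℝ ∞ reflB offAxis := fun x hx => by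
  have hx0 : cylRadius x ≠ 0 := by
    have : 1 / 2 < cylRadius x := hx
    linarith
  have h : ContDiffAt ℝ ∞ reflB x :=
    ((contDiffAt_const.sub (contDiffAt_cylRadius' hx0)).mul ((contDiffAt_cylRadius' hx0).inv hx0)).smul
      horizontalProjL.contDiff.contDiffAt
  exact h.contDiffWithinAt

/-- The height function `ρ(x) = 1 - r` is smooth off the axis. [folklore] -/
theorem contDiffOn_height : ContDiffOn ℝ ∞ (fun x : ℝ³ => 1 - cylRadius x) offAxis := fun x hx => by
  have hx0 : cylRadius x ≠ 0 := by
    have : 1 / 2 < cylRadius x := hx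
    linarith
  exact (contDiffAt_const.sub (contDiffAt_cylRadius' hx0)).contDiffWithinAt

/-- `B (x + s e₂) = B x`. [folklore] -/
theorem reflB_add_axialShift (x : ℝ³) (s : ℝ) : reflB (x + 𝐯 s) = reflB x := by
  have hh : horizontalProjL (x + 𝐯 s) = horizontalProjL x := by
    rw [horizontalProjL_apply, horizontalProjL_apply, horizontalProj_add_axialShift]
  simp only [reflB, cylRadius_add_axialShift, hh]

/-- Derivatives of an axially invariant function are axially invariant. [folklore] -/
theorem iteratedFDeriv_add_axialShift_of_invariant {G : Type*} [NormedAddCommGroup G] [NormedSpace ℝ G]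
    {g : ℝ³ → G} {s : ℝ} (hg : ∀ x, g (x + 𝐯 s) = g x) (i : ℕ) (y : ℝ³) :
    iteratedFDeriv ℝ i g (y + 𝐯 s) = iteratedFDeriv ℝ i g y := by
  rw [← iteratedFDeriv_comp_add_right]
  congr 1
  exact funext hg

/-- **Uniform derivative bounds for the geometric factors on the closed collar**
`{1 ≤ r ≤ 3/2}` (all heights), up to order `n`: one constant `M ≥ 1` bounds `‖Dⁱ B‖` and
`‖Dⁱ ρ‖`, `i ≤ n`. [folklore] -/
theorem exists_bound_geom (n : ℕ) : ∃ M : ℝ, 1 ≤ M ∧ ∀ i ≤ n, ∀ x : ℝ³, 1 ≤ cylRadius x → cylRadius x ≤ 3 / 2 →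
    ‖iteratedFDeriv ℝ i reflB x‖ ≤ M ∧ ‖iteratedFDeriv ℝ i (fun y : ℝ³ => 1 - cylRadius y) x‖ ≤ M := by
  obtain ⟨MB, hMB0, hMB⟩ := exists_bound_iteratedFDeriv_of_isCompact isOpen_offAxis isCompact_collarSlice
    collarSlice_subset_offAxis contDiffOn_reflB n
  obtain ⟨MH, hMH0, hMH⟩ := exists_bound_iteratedFDeriv_of_isCompact isOpen_offAxis isCompact_collarSlice
    collarSlice_subset_offAxis contDiffOn_height n
  refine ⟨MB + MH + 1, by linarith, fun i hi x h1 h2 => ?_⟩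
  obtain ⟨y, hy, hxy⟩ := exists_collarSlice_add h1 h2
  constructor
  · rw [hxy, iteratedFDeriv_add_axialShift_of_invariant (fun z => reflB_add_axialShift z (x 2))]
    linarith [hMB i hi y hy]
  · rw [hxy, iteratedFDeriv_add_axialShift_of_invariant (g := fun y : ℝ³ => 1 - cylRadius y)
      (fun z => by simp only [cylRadius_add_axialShift])]
    linarith [hMH i hi y hy]

/-! ### Derivatives of the reflections -/

/-- The reflections are smooth off the axis. [folklore] -/
theorem contDiffOn_radialReflect (k : ℕ) : ContDiffOn ℝ ∞ (radialReflect k) offAxis := by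
  have h : radialReflect k = fun x => x + (1 + (2 : ℝ) ^ k) • reflB x := funext (radialReflect_eq_add k)
  rw [h]
  exact fun x hx => contDiffWithinAt_id.add ((contDiffOn_reflB x hx).const_smul _)

/-- **Derivative bounds for the reflections**: with the constant `M` of `exists_bound_geom`,
`‖Dⁱ R_k (x)‖ ≤ 3 M 2^k` on the closed collar for `1 ≤ i ≤ n`. [folklore] -/
theorem norm_iteratedFDeriv_radialReflect_le {n : ℕ} {M : ℝ} (hM1 : 1 ≤ M)
    (hM : ∀ i ≤ n, ∀ x : ℝ³, 1 ≤ cylRadius x → cylRadius x ≤ 3 / 2 →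
      ‖iteratedFDeriv ℝ i reflB x‖ ≤ M ∧ ‖iteratedFDeriv ℝ i (fun y : ℝ³ => 1 - cylRadius y) x‖ ≤ M)
    (k : ℕ) {i : ℕ} (hi1 : 1 ≤ i) (hin : i ≤ n) {x : ℝ³} (h1 : 1 ≤ cylRadius x) (h2 : cylRadius x ≤ 3 / 2) :
    ‖iteratedFDeriv ℝ i (radialReflect k) x‖ ≤ 3 * M * (2 : ℝ) ^ k := by
  have hxV : x ∈ offAxis := show 1 / 2 < cylRadius x by linarith
  have hV := isOpen_offAxis
  have h : radialReflect k = fun x => x + (1 + (2 : ℝ) ^ k) • reflB x := funext (radialReflect_eq_add k)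
  have hBa : ContDiffAt ℝ ∞ reflB x := contDiffOn_reflB.contDiffAt (hV.mem_nhds hxV)
  -- work within the open set `offAxis`
  have hBi : ContDiffWithinAt ℝ i reflB offAxis x := hBa.contDiffWithinAt.of_le (by exact_mod_cast le_top)
  have hfun : (fun y : ℝ³ => y + (1 + (2 : ℝ) ^ k) • reflB y) =
      (fun y : ℝ³ => y) + ((1 + (2 : ℝ) ^ k) • reflB) := by
    funext y; simp only [Pi.add_apply, Pi.smul_apply]
  have hf : ContDiffWithinAt ℝ i (fun y : ℝ³ => y) offAxis x := contDiffWithinAt_id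
  have hg : ContDiffWithinAt ℝ i ((1 + (2 : ℝ) ^ k) • reflB) offAxis x := by
    have := hBi.const_smul (1 + (2 : ℝ) ^ k)
    exact this
  rw [← iteratedFDerivWithin_of_isOpen i hV hxV, h, hfun,
    iteratedFDerivWithin_add_apply hf hg hV.uniqueDiffOn hxV,
    iteratedFDerivWithin_const_smul_apply hBi hV.uniqueDiffOn hxV,
    iteratedFDerivWithin_of_isOpen i hV hxV, iteratedFDerivWithin_of_isOpen i hV hxV]
  have hid : ‖iteratedFDeriv ℝ i (fun y : ℝ³ => y) x‖ ≤ 1 := by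
    rcases i with _ | i
    · omega
    rcases i with _ | i
    · rw [← iteratedFDerivWithin_univ, norm_iteratedFDerivWithin_one _ uniqueDiffWithinAt_univ,
        fderivWithin_univ]
      have : fderiv ℝ (fun y : ℝ³ => y) x = ContinuousLinearMap.id ℝ ℝ³ := fderiv_id
      rw [this]
      exact ContinuousLinearMap.norm_id_le
    · have : iteratedFDeriv ℝ (i + 2) (fun y : ℝ³ => y) x = 0 := by
        rw [iteratedFDeriv_succ_eq_comp_right]
        have hf : (fun y : ℝ³ => fderiv ℝ (fun y : ℝ³ => y) y) = fun _ => ContinuousLinearMap.id ℝ ℝ³ :=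
          funext fun y => fderiv_fun_id
        simp only [Function.comp_apply, hf, iteratedFDeriv_succ_const, Pi.zero_apply, map_zero]
      rw [this, norm_zero]; exact zero_le_one
  have hB : ‖iteratedFDeriv ℝ i reflB x‖ ≤ M := (hM i hin x h1 h2).1
  have h2k : (1 : ℝ) ≤ (2 : ℝ) ^ k := one_le_pow₀ (by norm_num)
  calc ‖iteratedFDeriv ℝ i (fun y : ℝ³ => y) x + (1 + (2 : ℝ) ^ k) • iteratedFDeriv ℝ i reflB x‖
      ≤ 1 + (1 + (2 : ℝ) ^ k) * M := by
        refine (norm_add_le _ _).trans (add_le_add hid ?_)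
        rw [norm_smul, Real.norm_of_nonneg (by positivity)]
        exact mul_le_mul_of_nonneg_left hB (by positivity)
    _ ≤ 3 * M * (2 : ℝ) ^ k := by nlinarith


/-! ### The weights in the radial variable -/

/-- **Derivative bound for Seeley's weights** (one variable): `‖Dʲ w_k (t)‖ ≤ |a_k| C_j (2^k/δ)^j`
(chain rule for `t ↦ φ(2^k t/δ)`, `iteratedFDeriv_comp_const_smul`, and the cutoff bounds). [cite: Seeley1964, Theorem] -/
theorem norm_iteratedFDeriv_weight_real_le {δ : ℝ} (hδ : 0 < δ) (k j : ℕ) (t : ℝ) :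
    ‖iteratedFDeriv ℝ j (Seeley.weight δ k) t‖ ≤ |Seeley.coeff k| * Seeley.cutoffBound j * (2 ^ k / δ) ^ j := by
  have hcut : ContDiff ℝ j Seeley.cutoff := Seeley.contDiff_cutoff
  have hw : Seeley.weight δ k = fun t => Seeley.coeff k • (fun s => Seeley.cutoff ((2 ^ k / δ) • s)) t := by
    funext t
    simp only [Seeley.weight, smul_eq_mul]
    congr 1
    ring
  have hcd : ContDiffAt ℝ j (fun s : ℝ => Seeley.cutoff ((2 ^ k / δ) • s)) t := by
    have h1 : ContDiff ℝ j (fun s : ℝ => (2 ^ k / δ) • s) := contDiff_id.const_smul (2 ^ k / δ)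
    exact (hcut.comp h1).contDiffAt
  rw [hw, iteratedFDeriv_const_smul_apply' hcd, norm_smul, Real.norm_eq_abs, mul_assoc]
  refine mul_le_mul_of_nonneg_left ?_ (abs_nonneg _)
  rw [iteratedFDeriv_comp_const_smul (2 ^ k / δ) hcut]
  simp only [norm_smul, norm_pow, Real.norm_of_nonneg (show (0 : ℝ) ≤ 2 ^ k / δ by positivity)]
  rw [mul_comm]
  exact mul_le_mul_of_nonneg_right (Seeley.norm_iteratedFDeriv_cutoff_le j _) (by positivity)

/-- A cumulative cutoff constant `C̄_n = ∑_{j ≤ n} C_j` dominating every `C_j`, `j ≤ n`. [folklore] -/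
def cutoffBoundSum (n : ℕ) : ℝ := ∑ j ∈ range (n + 1), Seeley.cutoffBound j

/-- `C̄_n ≥ 0`. [folklore] -/
theorem cutoffBoundSum_nonneg (n : ℕ) : 0 ≤ cutoffBoundSum n :=
  sum_nonneg fun j _ => Seeley.cutoffBound_nonneg j

/-- `C_j ≤ C̄_n` for `j ≤ n`. [folklore] -/
theorem cutoffBound_le_sum {j n : ℕ} (h : j ≤ n) : Seeley.cutoffBound j ≤ cutoffBoundSum n :=
  single_le_sum (f := Seeley.cutoffBound) (fun i _ => Seeley.cutoffBound_nonneg i) (mem_range.2 (Nat.lt_succ_of_le h))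

/-- With `δ = 1/2`: `‖Dʲ w_k‖ ≤ |a_k| C̄_n (2^{k+1})^i` for `j ≤ i ≤ n` (monotone form used in the
composition bound). [folklore] -/
theorem norm_iteratedFDeriv_weight_half_le {k j i n : ℕ} (hji : j ≤ i) (hin : i ≤ n) (t : ℝ) :
    ‖iteratedFDeriv ℝ j (Seeley.weight (1 / 2 : ℝ) k) t‖ ≤
      |Seeley.coeff k| * cutoffBoundSum n * ((2 : ℝ) ^ (k + 1)) ^ i := by
  refine (norm_iteratedFDeriv_weight_real_le (by norm_num) k j t).trans ?_
  have h1 : (2 : ℝ) ^ k / (1 / 2) = (2 : ℝ) ^ (k + 1) := by rw [pow_succ]; ring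
  rw [h1]
  have h2 : ((2 : ℝ) ^ (k + 1)) ^ j ≤ ((2 : ℝ) ^ (k + 1)) ^ i :=
    pow_le_pow_right₀ (one_le_pow₀ (by norm_num)) hji
  have h3 : Seeley.cutoffBound j ≤ cutoffBoundSum n := cutoffBound_le_sum (hji.trans hin)
  exact mul_le_mul (mul_le_mul_of_nonneg_left h3 (abs_nonneg _)) h2 (by positivity)
    (mul_nonneg (abs_nonneg _) (cutoffBoundSum_nonneg n))

/-! ### The terms `T_k f` and their derivatives -/

/-- **The `k`-th reflected term** `T_k f (y) = w_k(1 - r) f(R_k y)` of the radial Seeley series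
(`rawExtend_of_one_lt`). [cite: Seeley1964, Theorem] -/
def seeleyTerm (k : ℕ) (f : ℝ³ → F) (y : ℝ³) : F :=
  Seeley.weight (1 / 2 : ℝ) k (1 - cylRadius y) • f (radialReflect k y)

/-- Unfolding. [folklore] -/
theorem seeleyTerm_apply (k : ℕ) (f : ℝ³ → F) (y : ℝ³) :
    seeleyTerm k f y = Seeley.weight (1 / 2 : ℝ) k (1 - cylRadius y) • f (radialReflect k y) := rfl

/-- Far from the wall (`2^k (r - 1) > 1/4`) the `k`-th term vanishes identically nearby, so all its
derivatives vanish. [folklore] -/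
theorem iteratedFDeriv_seeleyTerm_eq_zero (k : ℕ) (f : ℝ³ → F) {x : ℝ³}
    (hx : 1 / 4 < (2 : ℝ) ^ k * (cylRadius x - 1)) (j : ℕ) : iteratedFDeriv ℝ j (seeleyTerm k f) x = 0 := by
  have ho : IsOpen {y : ℝ³ | 1 / 4 < (2 : ℝ) ^ k * (cylRadius y - 1)} :=
    isOpen_lt continuous_const (continuous_const.mul (continuous_cylRadius.sub continuous_const))
  have hev : seeleyTerm k f =ᶠ[𝓝 x] fun _ => (0 : F) := by
    filter_upwards [ho.mem_nhds hx] with y hy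
    rw [seeleyTerm, seeley_weight_eq_zero hy.le, zero_smul]
  rw [(hev.iteratedFDeriv ℝ j).eq_of_nhds]
  rcases j with _ | j
  · ext; simp
  · rw [iteratedFDeriv_succ_const, Pi.zero_apply]

/-- The `k`-th term is smooth on the active collar `U_k`. [folklore] -/
theorem contDiffOn_seeleyTerm (k : ℕ) {f : ℝ³ → F} (hf : ContDiffOn ℝ ∞ f 𝕂) :
    ContDiffOn ℝ ∞ (seeleyTerm k f) (collarK k) := fun _ hx =>
  (contDiffAt_weight_smul_reflect hf k hx.1.1).contDiffWithinAt

/-- On the active collar the reflection maps into the open cylinder. [folklore] -/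
theorem mapsTo_radialReflect (k : ℕ) : MapsTo (radialReflect k) (collarK k) (unitCylinder : Set ℝ³) :=
  fun _ hx => cylRadius_radialReflect_lt_one hx.1.1 (by linarith [hx.2])

/-- **Pointwise bound for the derivatives of the reflected terms** (Seeley 1964, proof of the
Theorem): for every `n` there is `K` such that for all `k`, all `f` smooth on the closed cylinder,
all `x ∈ U_k` and all `j ≤ n`,
`‖Dʲ (T_k f)(x)‖ ≤ K |a_k| 4^{kn} ∑_{l ≤ n} ‖Dˡ f (R_k x)‖`. [cite: Seeley1964, Theorem] -/
theorem norm_iteratedFDeriv_seeleyTerm_le (n : ℕ) : ∃ K : ℝ, 0 ≤ K ∧ ∀ (k : ℕ) (f : ℝ³ → F),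
    ContDiffOn ℝ ∞ f 𝕂 → ∀ x ∈ collarK k, ∀ j ≤ n,
      ‖iteratedFDeriv ℝ j (seeleyTerm k f) x‖ ≤
        K * |Seeley.coeff k| * ((2 : ℝ) ^ k) ^ (2 * n) *
          ∑ l ∈ range (n + 1), ‖iteratedFDeriv ℝ l f (radialReflect k x)‖ := by
  obtain ⟨M, hM1, hM⟩ := exists_bound_geom n
  have hM0 : 0 ≤ M := zero_le_one.trans hM1
  have hCB0 : 0 ≤ cutoffBoundSum n := cutoffBoundSum_nonneg n
  -- the constant
  set K : ℝ := 2 ^ n * ((n ! : ℝ) * (n ! : ℝ)) * cutoffBoundSum n * 2 ^ n * M ^ n * (3 * M) ^ n with hK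
  refine ⟨K, by positivity, fun k f hf x hx j hjn => ?_⟩
  have hs : IsOpen (collarK k) := isOpen_collarK k
  have hsu : UniqueDiffOn ℝ (collarK k) := hs.uniqueDiffOn
  have ht : IsOpen (unitCylinder : Set ℝ³) := unitCylinder.isOpen
  have htu : UniqueDiffOn ℝ (unitCylinder : Set ℝ³) := ht.uniqueDiffOn
  have hx1 : 1 < cylRadius x := hx.1.1
  have hx2 : cylRadius x < 3 / 2 := hx.1.2
  have hxoff : x ∈ offAxis := show 1 / 2 < cylRadius x by linarith
  have h2k : (1 : ℝ) ≤ (2 : ℝ) ^ k := one_le_pow₀ (by norm_num)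
  -- the two factors
  set a : ℝ³ → ℝ := fun y => Seeley.weight (1 / 2 : ℝ) k (1 - cylRadius y) with ha
  set u : ℝ³ → F := f ∘ radialReflect k with hu
  have hterm : seeleyTerm k f = fun y => a y • u y := rfl
  have haC : ContDiffOn ℝ ∞ a (collarK k) :=
    (Seeley.contDiff_weight (1 / 2 : ℝ) k).comp_contDiffOn (contDiffOn_height.mono fun y hy =>
      show 1 / 2 < cylRadius y by linarith [hy.1.1])
  have hfo : ContDiffOn ℝ ∞ f (unitCylinder : Set ℝ³) := hf.mono subset_closure
  have hRo : ContDiffOn ℝ ∞ (radialReflect k) (collarK k) :=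
    (contDiffOn_radialReflect k).mono fun y hy => show 1 / 2 < cylRadius y by linarith [hy.1.1]
  have huC : ContDiffOn ℝ ∞ u (collarK k) := hfo.comp hRo (mapsTo_radialReflect k)
  -- the data bound `Cf`
  set Cf : ℝ := ∑ l ∈ range (n + 1), ‖iteratedFDeriv ℝ l f (radialReflect k x)‖ with hCf
  have hCf0 : 0 ≤ Cf := sum_nonneg fun l _ => norm_nonneg _
  -- Step 1: Leibniz
  have hLeib := norm_iteratedFDerivWithin_smul_le (𝕜 := ℝ) haC huC hsu hx (n := j) (by exact_mod_cast le_top)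
  rw [← iteratedFDerivWithin_of_isOpen j hs hx, hterm]
  refine hLeib.trans ?_
  -- Step 2: the weight factor
  have hA : ∀ i ≤ j, ‖iteratedFDerivWithin ℝ i a (collarK k) x‖ ≤
      (i ! : ℝ) * (|Seeley.coeff k| * cutoffBoundSum n * ((2 : ℝ) ^ (k + 1)) ^ i) * M ^ i := by
    intro i hij
    have hin : i ≤ n := hij.trans hjn
    have hcomp := norm_iteratedFDerivWithin_comp_le (𝕜 := ℝ) (g := Seeley.weight (1 / 2 : ℝ) k)
      (f := fun y : ℝ³ => 1 - cylRadius y) (n := i) (s := collarK k) (t := univ) (x := x)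
      (N := ∞) (Seeley.contDiff_weight (1 / 2 : ℝ) k).contDiffOn
      (contDiffOn_height.mono fun y hy => show 1 / 2 < cylRadius y by linarith [hy.1.1])
      (by exact_mod_cast le_top) uniqueDiffOn_univ hsu (mapsTo_univ _ _) hx
      (C := |Seeley.coeff k| * cutoffBoundSum n * ((2 : ℝ) ^ (k + 1)) ^ i) (D := M)
      (fun i' hi' => by
        rw [iteratedFDerivWithin_univ]
        exact norm_iteratedFDeriv_weight_half_le hi' hin _)
      (fun i' hi1 hi' => by
        rw [iteratedFDerivWithin_of_isOpen i' hs hx]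
        refine ((hM i' (hi'.trans hin) x hx1.le (by linarith)).2).trans ?_
        exact le_self_pow₀ hM1 (by omega))
    exact hcomp
  -- Step 3: the reflected factor
  have hU : ∀ i ≤ j, ‖iteratedFDerivWithin ℝ i u (collarK k) x‖ ≤ (i ! : ℝ) * Cf * (3 * M * (2 : ℝ) ^ k) ^ i := by
    intro i hij
    have hin : i ≤ n := hij.trans hjn
    have hcomp := norm_iteratedFDerivWithin_comp_le (𝕜 := ℝ) (g := f) (f := radialReflect k) (n := i)
      (s := collarK k) (t := (unitCylinder : Set ℝ³)) (x := x) (N := ∞) hfo hRo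
      (by exact_mod_cast le_top) htu hsu (mapsTo_radialReflect k) hx (C := Cf) (D := 3 * M * (2 : ℝ) ^ k)
      (fun i' hi' => by
        rw [iteratedFDerivWithin_of_isOpen i' ht (mapsTo_radialReflect k hx)]
        exact single_le_sum (f := fun l => ‖iteratedFDeriv ℝ l f (radialReflect k x)‖)
          (fun l _ => norm_nonneg _) (mem_range.2 (by omega)))
      (fun i' hi1 hi' => by
        rw [iteratedFDerivWithin_of_isOpen i' hs hx]
        refine (norm_iteratedFDeriv_radialReflect_le hM1 hM k hi1 (hi'.trans hin) hx1.le (by linarith)).trans ?_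
        exact le_self_pow₀ (by nlinarith) (by omega))
    exact hcomp
  -- Step 4: combine
  have hpow2 : ∀ i ≤ n, ((2 : ℝ) ^ (k + 1)) ^ i ≤ 2 ^ n * ((2 : ℝ) ^ k) ^ n := by
    intro i hi
    calc ((2 : ℝ) ^ (k + 1)) ^ i ≤ ((2 : ℝ) ^ (k + 1)) ^ n :=
          pow_le_pow_right₀ (one_le_pow₀ (by norm_num)) hi
      _ = 2 ^ n * ((2 : ℝ) ^ k) ^ n := by rw [pow_succ, mul_pow, mul_comm]
  have hpow3 : ∀ i ≤ n, (3 * M * (2 : ℝ) ^ k) ^ i ≤ (3 * M) ^ n * ((2 : ℝ) ^ k) ^ n := by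
    intro i hi
    calc (3 * M * (2 : ℝ) ^ k) ^ i ≤ (3 * M * (2 : ℝ) ^ k) ^ n :=
          pow_le_pow_right₀ (by nlinarith) hi
      _ = (3 * M) ^ n * ((2 : ℝ) ^ k) ^ n := by rw [mul_pow]
  have hfac : ∀ i ≤ n, (i ! : ℝ) ≤ (n ! : ℝ) := fun i hi => by exact_mod_cast Nat.factorial_le hi
  have hMpow : ∀ i ≤ n, M ^ i ≤ M ^ n := fun i hi => pow_le_pow_right₀ hM1 hi
  -- each summand is at most `choose * T`
  set T : ℝ := ((n ! : ℝ) * (n ! : ℝ)) * cutoffBoundSum n * 2 ^ n * M ^ n * (3 * M) ^ n *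
    |Seeley.coeff k| * ((2 : ℝ) ^ k) ^ (2 * n) * Cf with hT
  have hsummand : ∀ i ∈ range (j + 1), (j.choose i : ℝ) * ‖iteratedFDerivWithin ℝ i a (collarK k) x‖ *
      ‖iteratedFDerivWithin ℝ (j - i) u (collarK k) x‖ ≤ (j.choose i : ℝ) * T := by
    intro i hi
    have hij : i ≤ j := Nat.lt_succ_iff.1 (mem_range.1 hi)
    have hin : i ≤ n := hij.trans hjn
    have hjin : j - i ≤ n := (Nat.sub_le j i).trans hjn
    rw [mul_assoc]
    refine mul_le_mul_of_nonneg_left ?_ (by positivity)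
    calc ‖iteratedFDerivWithin ℝ i a (collarK k) x‖ * ‖iteratedFDerivWithin ℝ (j - i) u (collarK k) x‖
        ≤ ((i ! : ℝ) * (|Seeley.coeff k| * cutoffBoundSum n * ((2 : ℝ) ^ (k + 1)) ^ i) * M ^ i) *
            (((j - i) ! : ℝ) * Cf * (3 * M * (2 : ℝ) ^ k) ^ (j - i)) :=
          mul_le_mul (hA i hij) (hU (j - i) (Nat.sub_le j i)) (norm_nonneg _) (by positivity)
      _ ≤ ((n ! : ℝ) * (|Seeley.coeff k| * cutoffBoundSum n * (2 ^ n * ((2 : ℝ) ^ k) ^ n)) * M ^ n) *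
            ((n ! : ℝ) * Cf * ((3 * M) ^ n * ((2 : ℝ) ^ k) ^ n)) := by
          have := hpow2 i hin
          have := hpow3 (j - i) hjin
          have := hfac i hin
          have := hfac (j - i) hjin
          have := hMpow i hin
          have h0 : 0 ≤ cutoffBoundSum n := cutoffBoundSum_nonneg n
          gcongr
      _ = T := by rw [hT]; ring
  calc ∑ i ∈ range (j + 1), (j.choose i : ℝ) * ‖iteratedFDerivWithin ℝ i a (collarK k) x‖ *
          ‖iteratedFDerivWithin ℝ (j - i) u (collarK k) x‖
      ≤ ∑ i ∈ range (j + 1), (j.choose i : ℝ) * T := sum_le_sum hsummand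
    _ = 2 ^ j * T := by
        rw [← sum_mul]
        congr 1
        have := Nat.sum_range_choose j
        exact_mod_cast this
    _ ≤ 2 ^ n * T := by
        have hT0 : 0 ≤ T := by positivity
        exact mul_le_mul_of_nonneg_right (pow_le_pow_right₀ (by norm_num) hjn) hT0
    _ = K * |Seeley.coeff k| * ((2 : ℝ) ^ k) ^ (2 * n) * Cf := by rw [hK, hT]; ring


/-! ### Change of variables under the reflections -/

/-- The reflection in the parameter space of the cylindrical coordinates:
`ψ_k (r, θ, z) = (1 - 2^k (r - 1), θ, z)`. [folklore] -/
def reflParam (k : ℕ) (p : Fin 3 → ℝ) : Fin 3 → ℝ := ![1 - (2 : ℝ) ^ k * (p 0 - 1), p 1, p 2]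

/-- Coordinates of `ψ_k`. [folklore] -/
@[simp] theorem reflParam_apply_zero (k : ℕ) (p : Fin 3 → ℝ) :
    reflParam k p 0 = 1 - (2 : ℝ) ^ k * (p 0 - 1) := rfl

/-- Coordinates of `ψ_k`. [folklore] -/
@[simp] theorem reflParam_apply_one (k : ℕ) (p : Fin 3 → ℝ) : reflParam k p 1 = p 1 := rfl

/-- Coordinates of `ψ_k`. [folklore] -/
@[simp] theorem reflParam_apply_two (k : ℕ) (p : Fin 3 → ℝ) : reflParam k p 2 = p 2 := rfl

/-- **The reflections in cylindrical coordinates**: `R_k (Φ(r, θ, z)) = Φ(1 - 2^k (r - 1), θ, z)`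
for `r > 0`. [folklore] -/
theorem radialReflect_cylCoord (k : ℕ) {p : Fin 3 → ℝ} (hp : 0 < p 0) :
    radialReflect k (cylCoord p) = cylCoord (reflParam k p) := by
  have hr : cylRadius (cylCoord p) = p 0 := cylRadius_cylCoord hp.le
  ext i
  fin_cases i
  · simp [radialReflect_eq, hr, horizontalProj_apply_eq]
    field_simp
  · simp [radialReflect_eq, hr, horizontalProj_apply_eq]
    field_simp
  · simp [radialReflect_eq, hr, horizontalProj_apply_eq]

/-- The linear part `D_k = diag(-2^k, 1, 1)` of `ψ_k`. [folklore] -/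
def reflParamLin (k : ℕ) : (Fin 3 → ℝ) →L[ℝ] (Fin 3 → ℝ) :=
  LinearMap.toContinuousLinearMap (Matrix.toLin' (Matrix.diagonal ![-(2 : ℝ) ^ k, 1, 1]))

/-- `D_k p i = d_i p_i`. [folklore] -/
theorem reflParamLin_apply (k : ℕ) (p : Fin 3 → ℝ) (i : Fin 3) :
    reflParamLin k p i = ![-(2 : ℝ) ^ k, 1, 1] i * p i := by
  simp [reflParamLin, Matrix.mulVec_diagonal]

/-- `ψ_k = D_k + (1 + 2^k, 0, 0)`. [folklore] -/
theorem reflParam_eq_lin_add (k : ℕ) (p : Fin 3 → ℝ) :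
    reflParam k p = reflParamLin k p + ![1 + (2 : ℝ) ^ k, 0, 0] := by
  ext i
  fin_cases i
  · simp [reflParamLin_apply]; ring
  · simp [reflParamLin_apply]
  · simp [reflParamLin_apply]

/-- `|det D_k| = 2^k`. [folklore] -/
theorem abs_det_reflParamLin (k : ℕ) : |(reflParamLin k).det| = (2 : ℝ) ^ k := by
  rw [ContinuousLinearMap.det, reflParamLin, LinearMap.coe_toContinuousLinearMap, LinearMap.det_toLin',
    Matrix.det_diagonal, Fin.prod_univ_three]
  simp

/-- `ψ_k` has derivative `D_k` everywhere. [folklore] -/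
theorem hasFDerivAt_reflParam (k : ℕ) (p : Fin 3 → ℝ) : HasFDerivAt (reflParam k) (reflParamLin k) p := by
  have h : reflParam k = fun q => reflParamLin k q + ![1 + (2 : ℝ) ^ k, 0, 0] := funext (reflParam_eq_lin_add k)
  rw [h]
  exact (reflParamLin k).hasFDerivAt.add_const _

/-- `ψ_k` is injective. [folklore] -/
theorem reflParam_injective (k : ℕ) : Injective (reflParam k) := by
  intro p q h
  have h0 := congr_fun h 0
  have h1 := congr_fun h 1
  have h2 := congr_fun h 2
  simp only [reflParam_apply_zero, reflParam_apply_one, reflParam_apply_two] at h0 h1 h2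
  have h2k : (0 : ℝ) < (2 : ℝ) ^ k := by positivity
  have h0' : p 0 = q 0 := by nlinarith
  ext i
  fin_cases i
  · exact h0'
  · exact h1
  · exact h2

/-- The thin collar of the change of variables: `{1 < r, 2^k (r - 1) < 1/4, 0 < z < L}`. [folklore] -/
def thinCollar (L : ℝ) (k : ℕ) : Set ℝ³ :=
  {x | 1 < cylRadius x ∧ (2 : ℝ) ^ k * (cylRadius x - 1) < 1 / 4 ∧ x 2 ∈ Set.Ioo 0 L}

/-- The thin collar is open. [folklore] -/
theorem isOpen_thinCollar (L : ℝ) (k : ℕ) : IsOpen (thinCollar L k) := by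
  refine (isOpen_lt continuous_const continuous_cylRadius).inter
    ((isOpen_lt (continuous_const.mul (continuous_cylRadius.sub continuous_const)) continuous_const).inter ?_)
  exact isOpen_Ioo.preimage (EuclideanSpace.proj (2 : Fin 3)).continuous

/-- **Change of variables under the radial reflections** (Jacobian `2^{-k} ≤ 1`, radii in
`(3/4, 5/4)`): for every measurable `G : ℝ³ → [0, ∞]`,
`∫⁻_{1 < r, 2^k(r-1) < 1/4, 0 < z < L} G(R_k x) dx ≤ 2 ∫⁻_{cell} G`. [cite: Seeley1964, Theorem] -/
theorem setLIntegral_comp_radialReflect_le (L : ℝ) (k : ℕ) (G : ℝ³ → ℝ≥0∞) :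
    ∫⁻ x in thinCollar L k, G (radialReflect k x) ≤ 2 * ∫⁻ x in (cylinderCell L : Set ℝ³), G x := by
  have h2k : (0 : ℝ) < (2 : ℝ) ^ k := by positivity
  have h2k1 : (1 : ℝ) ≤ (2 : ℝ) ^ k := one_le_pow₀ (by norm_num)
  set S := thinCollar L k with hSdef
  have hSm : MeasurableSet S := (isOpen_thinCollar L k).measurableSet
  -- the parameter sets
  set Reg : Set (Fin 3 → ℝ) := {p | 0 < p 0 ∧ p 1 ∈ Set.Ioo (-Real.pi) Real.pi} with hReg
  set S' : Set (Fin 3 → ℝ) := {p | 1 < p 0 ∧ (2 : ℝ) ^ k * (p 0 - 1) < 1 / 4 ∧ p 2 ∈ Set.Ioo 0 L} with hS'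
  have hRegm : MeasurableSet Reg := by
    have : IsOpen Reg := (isOpen_lt continuous_const (continuous_apply 0)).inter
      (isOpen_Ioo.preimage (continuous_apply 1))
    exact this.measurableSet
  have hS'm : MeasurableSet S' := by
    have : IsOpen S' := (isOpen_lt continuous_const (continuous_apply 0)).inter
      ((isOpen_lt (continuous_const.mul ((continuous_apply 0).sub continuous_const)) continuous_const).inter
        (isOpen_Ioo.preimage (continuous_apply 2)))
    exact this.measurableSet
  -- Step 1: cylindrical coordinates
  have hR : ∫⁻ p in Reg ∩ S', ENNReal.ofReal (p 0) * G (cylCoord (reflParam k p)) =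
      ∫⁻ p in Reg, S'.indicator (fun p => ENNReal.ofReal (p 0) * G (cylCoord (reflParam k p))) p := by
    rw [lintegral_indicator hS'm, Measure.restrict_restrict hS'm, inter_comm]
  have h1 : ∫⁻ x in S, G (radialReflect k x) =
      ∫⁻ p in Reg ∩ S', ENNReal.ofReal (p 0) * G (cylCoord (reflParam k p)) := by
    rw [← lintegral_indicator hSm, lintegral_eq_lintegral_cylCoord, hR]
    refine setLIntegral_congr_fun hRegm fun p hp => ?_
    have hp0 : 0 < p 0 := hp.1
    have hr : cylRadius (cylCoord p) = p 0 := cylRadius_cylCoord hp0.le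
    by_cases hpS : p ∈ S'
    · have hmem : cylCoord p ∈ S := by
        refine ⟨?_, ?_, ?_⟩
        · rw [hr]; exact hpS.1
        · rw [hr]; exact hpS.2.1
        · rw [cylCoord_apply_two]; exact hpS.2.2
      rw [indicator_of_mem hpS, indicator_of_mem hmem, radialReflect_cylCoord k hp0]
    · have hnmem : cylCoord p ∉ S := by
        intro h
        apply hpS
        refine ⟨?_, ?_, ?_⟩
        · have := h.1; rwa [hr] at this
        · have := h.2.1; rwa [hr] at this
        · have := h.2.2; rwa [cylCoord_apply_two] at this
      rw [indicator_of_notMem hpS, indicator_of_notMem hnmem, mul_zero]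
  -- Step 2: bound the weight `r ≤ 5/4` and change variables
  have h2 : ∫⁻ p in Reg ∩ S', ENNReal.ofReal (p 0) * G (cylCoord (reflParam k p)) ≤
      ENNReal.ofReal (5 / 4) * ∫⁻ p in Reg ∩ S', G (cylCoord (reflParam k p)) := by
    rw [← lintegral_const_mul' _ _ ENNReal.ofReal_ne_top]
    refine setLIntegral_mono' (hRegm.inter hS'm) fun p hp => ?_
    refine mul_le_mul' (ENNReal.ofReal_le_ofReal ?_) le_rfl
    have : (2 : ℝ) ^ k * (p 0 - 1) < 1 / 4 := hp.2.2.1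
    nlinarith [hp.2.1]
  have h3 : ∫⁻ p in Reg ∩ S', G (cylCoord (reflParam k p)) =
      (ENNReal.ofReal ((2 : ℝ) ^ k))⁻¹ * ∫⁻ q in reflParam k '' (Reg ∩ S'), G (cylCoord q) := by
    have hcv := lintegral_image_eq_lintegral_abs_det_fderiv_mul volume (hRegm.inter hS'm)
      (fun p _ => (hasFDerivAt_reflParam k p).hasFDerivWithinAt) ((reflParam_injective k).injOn)
      (fun q => G (cylCoord q))
    simp only [abs_det_reflParamLin] at hcv
    rw [lintegral_const_mul' _ _ ENNReal.ofReal_ne_top] at hcv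
    rw [hcv, ← mul_assoc, ENNReal.inv_mul_cancel (by simp) ENNReal.ofReal_ne_top, one_mul]
  -- Step 3: the image lies in the box `{3/4 < ρ < 1} × (-π, π) × (0, L)`
  have himg : reflParam k '' (Reg ∩ S') ⊆ {q | 3 / 4 < q 0 ∧ q ∈ cylBoxOpen L} := by
    rintro q ⟨p, ⟨hpR, hpS⟩, rfl⟩
    have hlt : (2 : ℝ) ^ k * (p 0 - 1) < 1 / 4 := hpS.2.1
    have hpos : 0 < (2 : ℝ) ^ k * (p 0 - 1) := mul_pos h2k (by linarith [hpS.1])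
    refine ⟨by simp only [reflParam_apply_zero]; linarith, ?_⟩
    rw [mem_cylBoxOpen_iff]
    exact ⟨⟨by simp only [reflParam_apply_zero]; linarith, by simp only [reflParam_apply_zero]; linarith⟩,
      hpR.2, hpS.2.2⟩
  have h4 : ∫⁻ q in reflParam k '' (Reg ∩ S'), G (cylCoord q) ≤
      ENNReal.ofReal (4 / 3) * ∫⁻ q in cylBoxOpen L, ENNReal.ofReal (q 0) * G (cylCoord q) := by
    calc ∫⁻ q in reflParam k '' (Reg ∩ S'), G (cylCoord q)
        ≤ ∫⁻ q in {q | 3 / 4 < q 0 ∧ q ∈ cylBoxOpen L}, G (cylCoord q) := lintegral_mono_set himg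
      _ ≤ ∫⁻ q in {q | 3 / 4 < q 0 ∧ q ∈ cylBoxOpen L}, ENNReal.ofReal (4 / 3) * (ENNReal.ofReal (q 0) * G (cylCoord q)) := by
          refine setLIntegral_mono' ?_ fun q hq => ?_
          · have hbox : IsOpen (cylBoxOpen L) := by
              rw [show cylBoxOpen L = {p : Fin 3 → ℝ | p 0 ∈ Set.Ioo 0 1 ∧ p 1 ∈ Set.Ioo (-Real.pi) Real.pi ∧ p 2 ∈ Set.Ioo 0 L}
                from Set.ext fun p => mem_cylBoxOpen_iff]
              exact (isOpen_Ioo.preimage (continuous_apply 0)).inter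
                ((isOpen_Ioo.preimage (continuous_apply 1)).inter (isOpen_Ioo.preimage (continuous_apply 2)))
            exact (isOpen_lt continuous_const (continuous_apply 0)).measurableSet.inter hbox.measurableSet
          · rw [← mul_assoc, ← ENNReal.ofReal_mul (by norm_num)]
            have h1q : (1 : ℝ) ≤ 4 / 3 * q 0 := by linarith [hq.1]
            calc G (cylCoord q) = 1 * G (cylCoord q) := (one_mul _).symm
              _ ≤ ENNReal.ofReal (4 / 3 * q 0) * G (cylCoord q) :=
                  mul_le_mul' (by rw [← ENNReal.ofReal_one]; exact ENNReal.ofReal_le_ofReal h1q) le_rfl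
      _ = ENNReal.ofReal (4 / 3) * ∫⁻ q in {q | 3 / 4 < q 0 ∧ q ∈ cylBoxOpen L}, ENNReal.ofReal (q 0) * G (cylCoord q) :=
          lintegral_const_mul' _ _ ENNReal.ofReal_ne_top
      _ ≤ ENNReal.ofReal (4 / 3) * ∫⁻ q in cylBoxOpen L, ENNReal.ofReal (q 0) * G (cylCoord q) :=
          mul_le_mul' le_rfl (lintegral_mono_set fun q hq => hq.2)
  -- Step 4: assemble
  rw [h1]
  refine h2.trans ?_
  rw [h3]
  have hinv : (ENNReal.ofReal ((2 : ℝ) ^ k))⁻¹ ≤ 1 := by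
    rw [ENNReal.inv_le_one, ← ENNReal.ofReal_one]
    exact ENNReal.ofReal_le_ofReal h2k1
  calc ENNReal.ofReal (5 / 4) * ((ENNReal.ofReal ((2 : ℝ) ^ k))⁻¹ * ∫⁻ q in reflParam k '' (Reg ∩ S'), G (cylCoord q))
      ≤ ENNReal.ofReal (5 / 4) * (1 * (ENNReal.ofReal (4 / 3) *
          ∫⁻ q in cylBoxOpen L, ENNReal.ofReal (q 0) * G (cylCoord q))) :=
        mul_le_mul' le_rfl (mul_le_mul' hinv h4)
    _ = ENNReal.ofReal (5 / 4 * (4 / 3)) * ∫⁻ x in (cylinderCell L : Set ℝ³), G x := by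
        rw [one_mul, ← mul_assoc, ← ENNReal.ofReal_mul (by norm_num), ← setLIntegral_cylinderCell_eq_lintegral_cylBoxOpen]
    _ ≤ 2 * ∫⁻ x in (cylinderCell L : Set ℝ³), G x := by
        refine mul_le_mul' ?_ le_rfl
        rw [show (2 : ℝ≥0∞) = ENNReal.ofReal 2 by simp]
        exact ENNReal.ofReal_le_ofReal (by norm_num)

end PeriodicCylinder

end Literature.Analysis.FluidPDE
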